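import Mathlib.Algebra.Polynomial.Eval.Defs
import Mathlib.Data.Set.Card
import Literature.ModelTheory.FiniteModelTheory.BGSPrograms
import Literature.ModelTheory.FiniteModelTheory.CPT
import HarnessLib

/-!
# Choiceless Polynomial Time with counting: bounded BGS programs, acceptance, CPT+Card

Topic `Literature/ModelTheory/FiniteModelTheory`; the CONSTRUCTION item `defn-CPTCardProgram`
completing the interface `CPTInterface U` / the shape `CPTCapturesPTIME` of `CPT.lean`
(request `wi-03769`): with the programming language BGS+`Card` of `BGSPrograms.lean` (terms,
rules, one-step semantics over `HF (Fin n)`, critical/active objects) we define, following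
Blass–Gurevich–Shelah 1999 §5.1 and 2002 §2 verbatim:

* `CPTCardProgram` — a PTime (BOUNDED) program: a triple `(Π, p, q)` of a BGS program and two
  polynomials (1999, §5.1 "A PTime (bounded) program Π̄ is a triple Π̄ = (Π, p(n), q(n))");
* `CPTCardProgram.Accepts P G` / `.Rejects P G` — on a finite graph `G` with `n` vertices (the
  atoms), the run of `Π` HALTS after `l ≤ p(n)` steps, at most `q(n)` objects are active in it,
  and `Output` is `true` (resp. `false`) in the final state (1999, §5.1);
* `CPTCardProgram.Decides P C` — `P` accepts the members of `C` and rejects the non-members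
  (1999, §5.1: `(K, K')` is C̃PT-separated; 2002, §2: "the class of Boolean queries decidable by
  PTime bounded BGS programs"), `CPTCardDefinable C := ∃ P, P.Decides C` — **the class
  CPT+Card** of Boolean graph queries (2002, §2: "To add counting … include, in every state, the
  additional function Card … The resulting complexity class is called C̃PT+Card");
* the PINNING PREDICATE asked for by `CPT.lean`: `IsCPTCard L` — the interface `L` defines
  exactly the CPT+Card-definable classes — so that the Descriptive route's crux reads
  `∀ U (L : CPTInterface U), IsCPTCard L → ¬ L.Definable cfiQuery`, which follows from (and,
  granted one CPT+Card logic exists, is equivalent to) the interface-free form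
  `¬ CPTCardDefinable cfiQuery` (`IsCPTCard.not_definable`); planners may use either.
* ONE NAMED FACT (statement only, nothing asserted): `CPTCardInPTIME` — every bounded
  program's accepted and rejected classes are polynomial-time (1999, Thm 1; 2002, §2:
  C̃PT+Card ⊆ PTime; the Turing-machine interpreter is not formalised). ISOMORPHISM INVARIANCE
  (1999, §1, §4.3: the machines "do not distinguish between isomorphic structures") is PROVED in
  the companion `CPTCardInvariance.lean` (equivariance of the whole semantics under `HF.map`),
  giving `CPTCardDefinable C → IsIsoClosed C`; CLOSURE of `CPTCardDefinable` under complement,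
  intersection and union (negate `Output` after the run; run two programs on disjoint dynamic
  symbols in parallel and combine the outputs once both have halted — not printed as a theorem
  by BGS, implicit in 1999 §5.1/§6.3) is PROVED in the companion `CPTCardClosure.lean`. With
  these, `CPTCardDefinable` inhabits `CPTInterface` up to the effective compilation into
  `U`-programs (1999, Thm 1 is a uniform simulation), which needs an s-m-n property of the
  concrete `U` and is left, as for the route's `FaginBridge`, to the user of a concrete
  interpreter.
* PROVED sanity: the two one-step programs `Halt := true ∥ Output := b` decide `Set.univ`
  (`b = true`) and `∅` (`b = false`) with bounds `p = 1`, `q = n + 2` (`cptCardDefinable_univ`,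
  `cptCardDefinable_empty`): the machinery computes.

Conventions fixed here (each provably immaterial for `CPTCardDefinable`): polynomials have
natural coefficients; atoms count as critical (1999 §5.1; Dawar–Richerby–Rossman omit them —
a shift of `q` by `n`); `Halt` "holds" means `Halt = true` and the run is cut at the first
such stage; the number of active objects is an `ℕ∞`-cardinality (`Set.encard`, `⊤` if
infinite, so no junk value can satisfy the bound). NOT here: the fixed-point characterisations
(1999, §6), FO(IFP)+C ⊆ CPT+Card (1999, Thm 6 via Abiteboul–Vianu; the tree has no IFP+C yet),
the PTIME Turing-machine interpreter itself, Dawar–Richerby–Rossman's CPT-definability of CFI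
over ORDERED base graphs (2008, Thm 22; `cfiQuery` is the unordered query).

## References

* A. Blass, Y. Gurevich, S. Shelah, *Choiceless polynomial time*, Ann. Pure Appl. Logic 100
  (1999) 141–187 = arXiv:math/9705225, §5.1 (PTime programs, C̃PT), §5.2 Thm 1 (simulation by
  PTime Turing machines), §1 and §4.3 (isomorphism invariance).
* A. Blass, Y. Gurevich, S. Shelah, *On polynomial time computation over unordered structures*,
  J. Symbolic Logic 67 (2002) 1093–1125 = arXiv:math/0102059, §2 (C̃PT+Card).
* A. Dawar, D. Richerby, B. Rossman, *Choiceless polynomial time, counting and the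
  Cai–Fürer–Immerman graphs*, Ann. Pure Appl. Logic 152 (2008), §2 (Def. of CPT(Card) programs).
-/

noncomputable section

open Literature.Computability.MetaComplexity

namespace Literature.ModelTheory.FiniteModelTheory

/-! ### Bounded programs and acceptance -/

/-- **A PTime-bounded BGS program with counting** (a "CPT(Card) program"): a triple
`(Π, p, q)` of a BGS+`Card` program `Π` over the graph vocabulary and two polynomials, `p`
bounding the number of steps and `q` the number of active objects, as functions of the number
`n` of atoms. [Blass–Gurevich–Shelah 1999, §5.1 ("PTime Programs"); Blass–Gurevich–Shelah 2002,
§2; Dawar–Richerby–Rossman 2008, §2] [cite: arXivmath9705225, §5.1] -/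
structure CPTCardProgram where
  /-- the BGS program `Π` -/
  prog : BGS.Program
  /-- the bound `p(n)` on the length of the run -/
  stepBound : Polynomial ℕ
  /-- the bound `q(n)` on the number of active objects of the run -/
  activeBound : Polynomial ℕ

namespace CPTCardProgram

/-- **`P` accepts `G`**: the run of `Π` on the graph `G` (atoms = the `n` vertices) halts at
some stage `l ≤ p(n)`, at most `q(n)` objects are active in `⟨A₀, …, A_l⟩`, and `Output = true`
in the final state `A_l`. [Blass–Gurevich–Shelah 1999, §5.1 ("Π̄ accepts … if the run of Π̄ on I
halts and Output equals true in the final state")] [cite: arXivmath9705225, §5.1] -/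
def Accepts (P : CPTCardProgram) (G : FinGraph) : Prop :=
  ∃ l, l ≤ P.stepBound.eval G.1 ∧ P.prog.HaltsAt G.2 l ∧
    (P.prog.activeSet G.2 l).encard ≤ ((P.activeBound.eval G.1 : ℕ) : ℕ∞) ∧
    (P.prog.stateAt G.2 l).output = HF.ofBool true

/-- **`P` rejects `G`**: as `Accepts`, with `Output = false` in the final state.
[Blass–Gurevich–Shelah 1999, §5.1] [cite: arXivmath9705225, §5.1] -/
def Rejects (P : CPTCardProgram) (G : FinGraph) : Prop :=
  ∃ l, l ≤ P.stepBound.eval G.1 ∧ P.prog.HaltsAt G.2 l ∧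
    (P.prog.activeSet G.2 l).encard ≤ ((P.activeBound.eval G.1 : ℕ) : ℕ∞) ∧
    (P.prog.stateAt G.2 l).output = HF.ofBool false

/-- A bounded program does not both accept and reject an input ("the classes of accepted and
rejected input structures are disjoint"). [Blass–Gurevich–Shelah 1999, §5.1] [folklore] -/
theorem not_rejects_of_accepts {P : CPTCardProgram} {G : FinGraph} (h : P.Accepts G) :
    ¬ P.Rejects G := by
  rintro ⟨l', -, hl', -, hout'⟩
  obtain ⟨l, -, hl, -, hout⟩ := h
  obtain rfl : l = l' := hl.unique hl'
  rw [hout] at hout'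
  exact absurd (HF.ofBool_injective hout') (by decide)

/-- **`P` decides the class `C`** (a Boolean query on finite graphs): it accepts every member and
rejects every non-member — `(C, Cᶜ)` is C̃PT+Card-separated by `P`. [Blass–Gurevich–Shelah
1999, §5.1 (C̃PT; "a class K is in C̃PT if the pair (K, K') is"); Blass–Gurevich–Shelah 2002, §2
("Boolean queries decidable by PTime bounded BGS programs")] [cite: arXivmath9705225, §5.1] -/
def Decides (P : CPTCardProgram) (C : Set FinGraph) : Prop :=
  ∀ G, (G ∈ C → P.Accepts G) ∧ (G ∉ C → P.Rejects G)

/-- A decided class is the class of accepted inputs. [folklore] -/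
theorem Decides.setOf_accepts_eq {P : CPTCardProgram} {C : Set FinGraph} (h : P.Decides C) :
    {G | P.Accepts G} = C := by
  ext G
  refine ⟨fun hG => by_contra fun hGC => not_rejects_of_accepts hG ((h G).2 hGC),
    fun hG => (h G).1 hG⟩

/-- A decided class is the complement of the class of rejected inputs. [folklore] -/
theorem Decides.setOf_rejects_eq {P : CPTCardProgram} {C : Set FinGraph} (h : P.Decides C) :
    {G | P.Rejects G} = Cᶜ := by
  ext G
  refine ⟨fun hG hGC => not_rejects_of_accepts ((h G).1 hGC) hG, fun hG => (h G).2 hG⟩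

/-- A program decides at most one class. [folklore] -/
theorem Decides.unique {P : CPTCardProgram} {C D : Set FinGraph} (hC : P.Decides C)
    (hD : P.Decides D) : C = D := by
  rw [← hC.setOf_accepts_eq, hD.setOf_accepts_eq]

end CPTCardProgram

/-- **CPT+Card-DEFINABILITY of a Boolean query** on finite graphs: some PTime-bounded BGS
program with counting decides it (accepts the members, rejects the non-members). This is the
class C̃PT+Card (= CPT(Card), CPT with counting); Dawar–Richerby–Rossman equivalently build the
resource bounds into the notion of program (2008, Def. 3.1: the run on every input has at most
`|I|^p` steps and `|I|^q` active objects) and accept iff `Output = 1` at the halt.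
[Blass–Gurevich–Shelah 2002, §2 ("the class of Boolean queries decidable by PTime bounded BGS
programs … The resulting complexity class is called C̃PT+Card"); Blass–Gurevich–Shelah 1999,
§5.1; Dawar–Richerby–Rossman 2008, Def. 3.1] [cite: BlassGurevichShelah2002, §2] -/
def CPTCardDefinable (C : Set FinGraph) : Prop :=
  ∃ P : CPTCardProgram, P.Decides C

/-! ### Pinning the interface of `CPT.lean` -/

/-- **The pinning predicate for `CPTInterface`**: the Gurevich logic `L` (with Boolean-closed
definable classes) IS Choiceless Polynomial Time with counting in the sense that its definable
classes of finite graphs are exactly the CPT+Card-definable ones. (BGS: C̃PT+Card is a logic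
whose sentences are the PTime programs; `L` may present them by any decidable coding and any
polynomial-time compilation into `U`-programs, cf. 1999 Thm 1.) [Blass–Gurevich–Shelah 1999,
§5.1 ("there is a … logic that expresses exactly C̃PT properties; use PTime programs as
sentences")] [cite: arXivmath9705225, §5.1] -/
def IsCPTCard {U : UniversalMachine} (L : CPTInterface U) : Prop :=
  ∀ C : Set FinGraph, L.Definable C ↔ CPTCardDefinable C

namespace IsCPTCard

variable {U : UniversalMachine} {L : CPTInterface U}

/-- Under the pinning, `L`-definability is CPT+Card-definability. [folklore] -/
theorem definable_iff (h : IsCPTCard L) (C : Set FinGraph) : L.Definable C ↔ CPTCardDefinable C :=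
  h C

/-- The crux shape: a class that is not CPT+Card-definable is not definable in any interface
pinned to CPT+Card. [folklore] -/
theorem not_definable (h : IsCPTCard L) {C : Set FinGraph} (hC : ¬ CPTCardDefinable C) :
    ¬ L.Definable C := fun hL => hC ((h C).mp hL)

/-- Conversely a CPT+Card-definable class is definable in every pinned interface. [folklore] -/
theorem definable (h : IsCPTCard L) {C : Set FinGraph} (hC : CPTCardDefinable C) :
    L.Definable C := (h C).mpr hC

/-- A pinned interface captures PTIME iff every isomorphism-closed polynomial-time class of
finite graphs is CPT+Card-definable — the Blass–Gurevich–Shelah question in interface-free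
form. [Blass–Gurevich–Shelah 1999, §1] [folklore] -/
theorem capturesPTIME_iff (h : IsCPTCard L) :
    L.CapturesPTIME ↔ ∀ C : Set FinGraph, IsIsoClosed C → IsPTIMEClass C → CPTCardDefinable C := by
  refine ⟨fun hc C hC hP => (h C).mp (hc C hC hP), fun hc C hC hP => ?_⟩
  exact (h C).mpr (hc C hC hP)

/-- Two interfaces pinned to CPT+Card (over any universal machines) define the same classes.
[folklore] -/
theorem definable_iff_definable {U' : UniversalMachine} {L' : CPTInterface U'} (h : IsCPTCard L)
    (h' : IsCPTCard L') (C : Set FinGraph) : L.Definable C ↔ L'.Definable C :=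
  (h C).trans (h' C).symm

end IsCPTCard

/-- The interface-free form of the route shape `CPTCapturesPTIME IsCPTCard` (`CPT.lean`): if some
isomorphism-closed polynomial-time class is not CPT+Card-definable then NO pinned interface
captures PTIME. [Blass–Gurevich–Shelah 1999, §1] [folklore] -/
theorem not_capturesPTIME_of_not_cptCardDefinable {U : UniversalMachine} {C : Set FinGraph}
    (hC : IsIsoClosed C) (hP : IsPTIMEClass C) (hnd : ¬ CPTCardDefinable C)
    (L : CPTInterface U) (hL : IsCPTCard L) : ¬ L.CapturesPTIME :=
  L.not_capturesPTIME_of_not_definable hC hP (hL.not_definable hnd)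

/-! ### The structural theorems of Blass–Gurevich–Shelah as named facts -/

/-- **CPT+Card ⊆ PTIME** (named fact): for every PTime-bounded BGS program with counting, the
classes of accepted and of rejected finite graphs are polynomial-time decidable (on adjacency
codes). Blass–Gurevich–Shelah prove it by simulating the bounded run on a Turing machine: the
guard `r` of comprehension terms and `do forall` rules keeps the number of immediate
subcomputations below the number `q(n)` of active objects, so one step costs polynomial work
and there are `≤ p(n)` steps. [Blass–Gurevich–Shelah 1999, §5.2 Thm 1 (without `Card`);
Blass–Gurevich–Shelah 2002, §2 (C̃PT+Card ⊆ PTime); Dawar–Richerby–Rossman 2008, §2 ("Both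
bounds are necessary to ensure that CPT(Card) ⊆ P")] [cite: arXivmath9705225, Thm 1] -/
def CPTCardInPTIME : Prop :=
  ∀ P : CPTCardProgram, IsPTIMEClass {G | P.Accepts G} ∧ IsPTIMEClass {G | P.Rejects G}

/-- Consequence of `CPTCardInPTIME`: every CPT+Card-definable class is polynomial-time.
[Blass–Gurevich–Shelah 1999, §5.2 Cor. 1] [folklore] -/
theorem CPTCardDefinable.isPTIMEClass (hT : CPTCardInPTIME) {C : Set FinGraph}
    (h : CPTCardDefinable C) : IsPTIMEClass C := by
  obtain ⟨P, hP⟩ := h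
  rw [← hP.setOf_accepts_eq]
  exact (hT P).1

/-! ### Sanity: the constant programs decide `Set.univ` and `∅` -/

namespace BGS

variable {n : ℕ}

/-- The one-step program `do-in-parallel Halt := true, Output := b enddo`. [folklore] -/
def constRule (b : Bool) : Rule :=
  Rule.par 0 (.update haltSym .nil .cTrue) (.update outputSym .nil (if b then .cTrue else .cFalse))

/-- `constRule b` is closed. [folklore] -/
theorem constRule_FV (b : Bool) : (constRule b).FV = ∅ := by
  cases b <;> decide

/-- The constant program with output `b`. [folklore] -/
def constProgram (b : Bool) : Program := ⟨constRule b, constRule_FV b⟩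

/-- The update set of the constant program in ANY state: `{(Halt, true), (Output, b)}`.
[folklore] -/
theorem den_constRule (b : Bool) (G : SimpleGraph (Fin n)) (S : DynState n) (σ : Env n) :
    (constRule b).den G S σ =
      {((haltSym, []), HF.ofBool true), ((outputSym, []), HF.ofBool b)} := by
  have hval : ∀ τ : Env n, Term.eval G S (if b then .cTrue else .cFalse) τ = HF.ofBool b := by
    intro τ; cases b <;> rfl
  have h01 : (HF.ofBool false : Obj n) ≠ HF.ofBool true := by simp
  ext u
  simp only [constRule, Rule.par, Rule.den, Term.eval, Args.eval, Finset.mem_biUnion,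
    HF.mem_members, HF.mem_pair, Finset.mem_insert, Finset.mem_singleton]
  constructor
  · rintro ⟨a, ha, hu⟩
    rcases ha with rfl | rfl
    · rw [Function.update_self, eqB_self, if_pos rfl, Finset.mem_singleton] at hu
      exact Or.inl hu
    · rw [Function.update_self, eqB_of_ne h01.symm, if_neg h01, Finset.mem_singleton, hval] at hu
      exact Or.inr hu
  · rintro (rfl | rfl)
    · refine ⟨HF.ofBool false, Or.inl rfl, ?_⟩
      rw [Function.update_self, eqB_self, if_pos rfl, Finset.mem_singleton]
    · refine ⟨HF.ofBool true, Or.inr rfl, ?_⟩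
      rw [Function.update_self, eqB_of_ne h01.symm, if_neg h01, Finset.mem_singleton, hval]

/-- That update set is consistent (`Halt ≠ Output`). [folklore] -/
theorem consistent_den_constRule (b : Bool) :
    Consistent ({((haltSym, []), HF.ofBool true), ((outputSym, []), HF.ofBool b)} :
      Finset (Update n)) := by
  intro u hu u' hu' h
  simp only [Finset.mem_insert, Finset.mem_singleton] at hu hu'
  rcases hu with rfl | rfl <;> rcases hu' with rfl | rfl
  · rfl
  · exact absurd (show haltSym = outputSym from congrArg Prod.fst h) (by decide)
  · exact absurd (show outputSym = haltSym from congrArg Prod.fst h) (by decide)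
  · rfl

/-- One step of the constant program from any state sets `Halt := true`, `Output := b` and
changes nothing else. [folklore] -/
theorem step_constProgram (b : Bool) (G : SimpleGraph (Fin n)) (S : DynState n) (f : ℕ)
    (args : List (Obj n)) :
    (constProgram b).step G S f args =
      if f = haltSym ∧ args = [] then HF.ofBool true
      else if f = outputSym ∧ args = [] then HF.ofBool b else S f args := by
  have hden := den_constRule b G S (fun _ => ∅)
  have hc := consistent_den_constRule (n := n) b
  show fire S ((constRule b).den G S fun _ => ∅) f args = _
  rw [hden]
  split_ifs with h1 h2
  · obtain ⟨rfl, rfl⟩ := h1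
    exact fire_apply_of_mem hc (by simp)
  · obtain ⟨rfl, rfl⟩ := h2
    exact fire_apply_of_mem hc (by simp)
  · refine fire_apply_of_forall_not_mem fun c hc' => ?_
    simp only [Finset.mem_insert, Finset.mem_singleton, Prod.mk.injEq] at hc'
    rcases hc' with ⟨⟨rfl, rfl⟩, -⟩ | ⟨⟨rfl, rfl⟩, -⟩
    · exact h1 ⟨rfl, rfl⟩
    · exact h2 ⟨rfl, rfl⟩

/-- The state of the constant program after `i + 1` steps: `Halt = true`, `Output = b`, all
other locations `∅`. [folklore] -/
theorem stateAt_constProgram_succ (b : Bool) (G : SimpleGraph (Fin n)) (i : ℕ) (f : ℕ)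
    (args : List (Obj n)) :
    (constProgram b).stateAt G (i + 1) f args =
      if f = haltSym ∧ args = [] then HF.ofBool true
      else if f = outputSym ∧ args = [] then HF.ofBool b else ∅ := by
  induction i with
  | zero => rw [Program.stateAt_succ, step_constProgram]; rfl
  | succ i ih =>
    rw [Program.stateAt_succ, step_constProgram, ih]
    split_ifs <;> rfl

/-- The constant program halts at stage `1`. [folklore] -/
theorem haltsAt_constProgram (b : Bool) (G : SimpleGraph (Fin n)) : (constProgram b).HaltsAt G 1 := by
  refine ⟨fun i hi => ?_, ?_⟩
  · obtain rfl : i = 0 := Nat.lt_one_iff.mp hi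
    show (∅ : Obj n) ≠ HF.ofBool true
    exact (HF.empty_ne_ordinal_succ 0)
  · show (constProgram b).stateAt G (0 + 1) haltSym [] = HF.ofBool true
    rw [stateAt_constProgram_succ, if_pos ⟨rfl, rfl⟩]

/-- Its output at stage `1` is `b`. [folklore] -/
theorem output_stateAt_constProgram (b : Bool) (G : SimpleGraph (Fin n)) :
    ((constProgram b).stateAt G 1).output = HF.ofBool b := by
  show (constProgram b).stateAt G (0 + 1) outputSym [] = HF.ofBool b
  rw [stateAt_constProgram_succ, if_neg (fun h => absurd h.1 (by decide)), if_pos ⟨rfl, rfl⟩]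

/-- In a state all of whose values are Boolean and all of whose non-`∅` locations are nullary,
the active objects are exactly the atoms, `0` and `1`. [Blass–Gurevich–Shelah 1999, §5.1]
[folklore] -/
theorem active_iff_of_boolean {S : DynState n} (hS : ∀ f args, (S f args).IsBool)
    (hS' : ∀ f args, S f args ≠ ∅ → args = []) (x : Obj n) :
    S.Active x ↔ x.IsAtom ∨ x.IsBool := by
  -- transitive closures of atoms and Booleans consist of Booleans
  have tcBool : ∀ y : Obj n, y.IsAtom ∨ y.IsBool → ∀ z ∈ y.tc, z.IsBool := by
    rintro y (⟨a, rfl⟩ | ⟨c, rfl⟩) z hz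
    · simp at hz
    · cases c
      · rw [HF.ofBool_false] at hz
        obtain ⟨w, hw, -⟩ := HF.mem_tc_iff.mp hz
        exact (HF.not_mem_empty w hw).elim
      · rw [HF.ofBool_true] at hz
        obtain ⟨w, hw, hzw⟩ := HF.mem_tc_iff.mp hz
        obtain ⟨m, hm, rfl⟩ := HF.mem_ordinal_iff.mp hw
        obtain rfl : m = 0 := Nat.lt_one_iff.mp hm
        rcases hzw with rfl | hz'
        · exact ⟨false, rfl⟩
        · obtain ⟨w', hw', -⟩ := HF.mem_tc_iff.mp hz'
          exact (HF.not_mem_empty w' hw').elim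
  have crit : ∀ y : Obj n, S.Critical y ↔ y.IsAtom ∨ y.IsBool := by
    intro y
    refine ⟨?_, fun h => h.elim Or.inl fun h => Or.inr (Or.inl h)⟩
    rintro (h | h | ⟨f, args, rfl⟩ | ⟨f, args, hne, hy⟩)
    · exact Or.inl h
    · exact Or.inr h
    · exact Or.inr (hS f args)
    · rw [hS' f args hne] at hy
      simp at hy
  constructor
  · rintro ⟨y, hy, hxy | hxy⟩
    · rw [hxy]; exact (crit y).mp hy
    · exact Or.inr (tcBool y ((crit y).mp hy) x hxy)
  · intro h
    exact ⟨x, (crit x).mpr h, Or.inl rfl⟩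

/-- The objects active in the run of the constant program are the atoms, `0` and `1`.
[folklore] -/
theorem activeSet_constProgram (b : Bool) (G : SimpleGraph (Fin n)) (l : ℕ) :
    (constProgram b).activeSet G l = {x | x.IsAtom ∨ x.IsBool} := by
  have key : ∀ i, ∀ x : Obj n, ((constProgram b).stateAt G i).Active x ↔ x.IsAtom ∨ x.IsBool := by
    intro i x
    cases i with
    | zero => exact active_iff_of_boolean (fun _ _ => ⟨false, rfl⟩) (fun _ _ h => (h rfl).elim) x
    | succ i =>
      refine active_iff_of_boolean (fun f args => ?_) (fun f args h => ?_) x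
      · rw [stateAt_constProgram_succ]
        split_ifs
        · exact ⟨true, rfl⟩
        · exact ⟨b, rfl⟩
        · exact ⟨false, rfl⟩
      · rw [stateAt_constProgram_succ] at h
        split_ifs at h with h1 h2
        · exact h1.2
        · exact h2.2
        · exact (h rfl).elim
  ext x
  simp only [Program.activeSet, Set.mem_setOf_eq, key]
  exact ⟨fun ⟨_, _, h⟩ => h, fun h => ⟨0, Nat.zero_le _, h⟩⟩

/-- There are exactly `n + 2` objects that are atoms or Boolean. [folklore] -/
theorem encard_setOf_isAtom_or_isBool (n : ℕ) :
    ({x : Obj n | x.IsAtom ∨ x.IsBool}).encard = n + 2 := by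
  classical
  have hset : {x : Obj n | x.IsAtom ∨ x.IsBool} =
      ↑((Finset.univ.image (HF.atom : Fin n → Obj n)) ∪ {HF.ofBool false, HF.ofBool true}) := by
    ext x
    simp only [Set.mem_setOf_eq, Finset.coe_union, Finset.coe_image, Finset.coe_univ,
      Set.image_univ, Finset.coe_insert, Finset.coe_singleton, Set.mem_union, Set.mem_range,
      Set.mem_insert_iff, Set.mem_singleton_iff, HF.IsAtom, HF.IsBool]
    constructor
    · rintro (⟨a, rfl⟩ | ⟨c, rfl⟩)
      · exact Or.inl ⟨a, rfl⟩
      · cases c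
        · exact Or.inr (Or.inl rfl)
        · exact Or.inr (Or.inr rfl)
    · rintro (⟨a, rfl⟩ | rfl | rfl)
      · exact Or.inl ⟨a, rfl⟩
      · exact Or.inr ⟨false, rfl⟩
      · exact Or.inr ⟨true, rfl⟩
  rw [hset, Set.encard_coe_eq_coe_finsetCard, Finset.card_union_of_disjoint,
    Finset.card_image_of_injective _ HF.atom_injective, Finset.card_univ, Fintype.card_fin,
    Finset.card_pair (by simp)]
  · push_cast; rfl
  · rw [Finset.disjoint_left]
    rintro x hx hx'
    simp only [Finset.mem_image, Finset.mem_univ, true_and] at hx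
    obtain ⟨a, rfl⟩ := hx
    simp only [Finset.mem_insert, Finset.mem_singleton] at hx'
    rcases hx' with h | h
    · exact HF.atom_ne_empty a (h.trans HF.ofBool_false)
    · exact HF.not_isAtom_ordinal 1 ⟨a, (h.trans HF.ofBool_true).symm⟩

end BGS

/-- The constant bounded program: `Halt := true ∥ Output := b`, `p = 1`, `q = n + 2`.
[folklore] -/
def CPTCardProgram.const (b : Bool) : CPTCardProgram :=
  ⟨BGS.constProgram b, 1, Polynomial.X + 2⟩

/-- The constant program with output `true` accepts every graph. [folklore] -/
theorem CPTCardProgram.const_true_accepts (G : FinGraph) : (CPTCardProgram.const true).Accepts G := by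
  refine ⟨1, by simp [CPTCardProgram.const], BGS.haltsAt_constProgram true G.2, ?_,
    BGS.output_stateAt_constProgram true G.2⟩
  have h2 : ((Polynomial.X + 2 : Polynomial ℕ).eval G.1) = G.1 + 2 := by simp
  show (BGS.Program.activeSet (BGS.constProgram true) G.2 1).encard ≤
    (((Polynomial.X + 2 : Polynomial ℕ).eval G.1 : ℕ) : ℕ∞)
  rw [BGS.activeSet_constProgram, BGS.encard_setOf_isAtom_or_isBool, h2]
  push_cast
  exact le_rfl

/-- The constant program with output `false` rejects every graph. [folklore] -/
theorem CPTCardProgram.const_false_rejects (G : FinGraph) : (CPTCardProgram.const false).Rejects G := by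
  refine ⟨1, by simp [CPTCardProgram.const], BGS.haltsAt_constProgram false G.2, ?_,
    BGS.output_stateAt_constProgram false G.2⟩
  have h2 : ((Polynomial.X + 2 : Polynomial ℕ).eval G.1) = G.1 + 2 := by simp
  show (BGS.Program.activeSet (BGS.constProgram false) G.2 1).encard ≤
    (((Polynomial.X + 2 : Polynomial ℕ).eval G.1 : ℕ) : ℕ∞)
  rw [BGS.activeSet_constProgram, BGS.encard_setOf_isAtom_or_isBool, h2]
  push_cast
  exact le_rfl

/-- **Non-vacuity**: the class of all finite graphs is CPT+Card-definable. [Blass–Gurevich–Shelah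
1999, §5.1] [folklore] -/
theorem cptCardDefinable_univ : CPTCardDefinable Set.univ :=
  ⟨CPTCardProgram.const true, fun G => ⟨fun _ => CPTCardProgram.const_true_accepts G,
    fun h => (h (Set.mem_univ G)).elim⟩⟩

/-- The empty class is CPT+Card-definable. [Blass–Gurevich–Shelah 1999, §5.1] [folklore] -/
theorem cptCardDefinable_empty : CPTCardDefinable ∅ :=
  ⟨CPTCardProgram.const false, fun G => ⟨fun h => h.elim,
    fun _ => CPTCardProgram.const_false_rejects G⟩⟩

/-- Hence `IsCPTCard` is consistent with the `true`/`false` axioms of the interface: a pinned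
interface defines `Set.univ` and `∅` (as every `CPTInterface` does). [folklore] -/
theorem IsCPTCard.definable_univ {U : UniversalMachine} {L : CPTInterface U} (h : IsCPTCard L) :
    L.Definable Set.univ := h.definable cptCardDefinable_univ

/-- Two interfaces over the same universal machine that are both pinned to CPT+Card have the
same definability predicate. [folklore] -/
theorem IsCPTCard.eq_of_definable {U : UniversalMachine} {L L' : CPTInterface U} (h : IsCPTCard L)
    (h' : IsCPTCard L') : L.Definable = L'.Definable :=
  funext fun C => propext (h.definable_iff_definable h' C)

end Literature.ModelTheory.FiniteModelTheory
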